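import Summits.HodgeConjecture.HodgeConjecture.Theorems.F0P3ProjectionPreservesType
import Summits.HodgeConjecture.HodgeConjecture.Theorems.F0P3ProjectionHolGermTransport
import Summits.HodgeConjecture.HodgeConjecture.Theorems.F0P2aL2bHolLieSpanPackage
import HarnessLib

/-!
# Crux `H413`, line `F0_U3CohMultOne` — P3 RUNG 1: letter (D)h REDUCED TO ITS ANALYTIC HALF (a `C¹` representative of the projected classes)

Floor-0 programme P3 «U3-mult», seat F0P3-p02 (g2); crux item stmt-HodgeConjecture-24833 (`HCCMUnconditional.H413`); ENGINE-INTERFACES §7 (3).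
HC_CM is proved only modulo the printed citations until rung 0 closes.

Letter (D)h ★ `CotangentForms.holCotFormSpectralProjection`: for a discrete automorphic `P` and a holomorphic cotangent form `Φ` with
square-integrable coordinates, the projected pair `(pr_P [Φ₀], pr_P [Φ₁])` is the pair of classes of a holomorphic cotangent form `Ψ`.
★ `F0P3ProjectionPreservesType` (the `K_∞`-type / `Kc` / level conjuncts) and ★ `F0P3ProjectionHolGermTransport` (holomorphic germs) transported
ALL FOUR conjuncts of `holCotForms ιinf Kc` (★ `mem_holCotForms_iff`) through `pr_P` at the level of classes and back to a `C¹` representative.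
This file assembles them:

* §1 (generic `adelicGroupData F E c N J`, `ιinf`, `Kc`, compact quotient, automorphic `μ`) `mem_holCotForms_of_representative`: if `Φ ∈
  holCotForms ιinf Kc` has continuous directional derivatives along `exp 𝔭` (hypothesis `hC1Φ`) and `Ψ` is a left-invariant function with
  continuous square-integrable coordinates, probes real-differentiable at `0`, continuous directional derivatives, AND CLASSES
  `[Ψ_j] = pr_P [Φ_j]`, then `Ψ ∈ holCotForms ιinf Kc`; `exists_holCotForm_of_representative` — the conclusion of (D)h in its own shape.
* §2 (the CM frame `(L, ι, H, T, hT)` of the letter, `(ιinf, Kc) = (cmArchSection, cmCompactFactor)`): the regularity hypothesis on `Φ` is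
  DISCHARGED — `continuous_fderivGerm_of_mem_holCotForms_cm` (holomorphic cotangent forms are arch-smooth with continuous Lie derivatives,
  F0P2a-p03's ★ `F0P2aL2bHolLieSpanPackage.iterLieDeriv_hol_package`, read through ★ `BallForms.expMem_smul_liePMat`:
  `lieDeriv cmArchSection (liePMat b) (Φ · j) = ∂_b Φ_j`), and the quotient is compact under the letter's definiteness hypothesis
  (`compactSpace_automorphicQuotient_cm`); hence `mem_holCotForms_of_representative_cm` / **`holCotFormSpectralProjection_of_representative`**:
  IN THE EXACT SETTING OF THE LETTER, (D)h holds for `(P, Φ)` as soon as the projected pair of classes has a `C¹`-along-`𝔭` continuous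
  representative — the output of the regularity letter F2 («`K_∞`-finite `𝒵`-finite `L²` classes on the compact quotient are smooth»,
  [BorelJacquet1979, 4.3 (i)]; [Borel1997, Thm. 2.13 and §8.4]; [HarishChandra1968]).  No letter is assumed here; no definition; no sorry.

References: [BorelJacquet1979] §4.3, §4.6; [Borel1997] §5.14, Thm. 2.13, §8.4; [BorelWallach2000] VII 2.10, XIII 1.2; [HarishChandraTAMS1953] §9–10.
-/

-- the mandated namespace repeats `HodgeConjecture.HodgeConjecture`, as in every `Theorems/*.lean` of this sub-problem
set_option linter.dupNamespace false

-- Mathlib idiom (Mathlib/Algebra/Lie/OfAssociative.lean); needed to mention the Lie algebra `u21Group.lie` of matrices (as in ★ `UnitaryBallLieDerivative`)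
attribute [local instance 100] LieRing.ofAssociativeRing

noncomputable section

open MeasureTheory NumberField MulAction Filter
open scoped ENNReal Topology Matrix ComplexOrder

namespace Summit.HodgeConjecture.HodgeConjecture.Cruxes.H413.F0P3HolProjectionReduction

open Literature.NumberTheory.Automorphic Literature.NumberTheory.Automorphic.UnitaryGroup
open Literature.NumberTheory.Automorphic.UnitaryGroup.CotangentForms (toQuotFun toQuotFun_mk germAt IsHolGerm holGerms mem_holGerms
  holCotForms mem_holCotForms_iff smoothFun rightRep cmArchSection cmCompactFactor)
open Literature.AlgebraicGeometry.ShimuraVarieties (BallForms.expP BallForms.expP_add_smul BallForms.expP_zero BallForms.u21Group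
  BallForms.liePMat BallForms.liePMatL BallForms.expMem_smul_liePMat BallForms.expMem_liePMat BallForms.isPullbackCocycle_cotangentCocycle)
open Literature.Geometry.ComplexHyperbolic.BallModel (U21 x₀)
open Summit.HodgeConjecture.HodgeConjecture.Cruxes.H413.SpectrumJunction
open Summit.HodgeConjecture.HodgeConjecture.Cruxes.H413.F0P3ProjectionPreservesType
open Summit.HodgeConjecture.HodgeConjecture.Cruxes.H413.F0P3ProjectionHolGermTransport

/-! ## §1 Generic: a `C¹` representative of the projected classes of a holomorphic cotangent form is a holomorphic cotangent form -/

section Generic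

variable {F E : Type} [Field F] [NumberField F] [Field E] [NumberField E] [Algebra F E]
  {c : E ≃ₐ[F] E} {N : ℕ} {J : Matrix (Fin N) (Fin N) E}
  {ιinf : U21 →* (adelicGroupData F E c N J).Adelic} {Kc : Subgroup (adelicGroupData F E c N J).Adelic}
  {μ : Measure (adelicGroupData F E c N J).automorphicQuotient} [(adelicGroupData F E c N J).IsAutomorphicMeasure μ]
  [CompactSpace (adelicGroupData F E c N J).automorphicQuotient]

/-- **A `C¹` REPRESENTATIVE OF THE PROJECTED CLASSES IS A HOLOMORPHIC COTANGENT FORM.**  Let `P` be discrete automorphic, `Φ ∈ holCotForms ιinf Kc`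
with square-integrable coordinates and continuous directional derivatives along `exp 𝔭` (`hC1Φ`), and `Ψ` a left-`U(J)(F)`-invariant `ℂ²`-valued
function with CONTINUOUS square-integrable coordinates, probes `b ↦ Ψ (x · ιinf (expP b))` real-differentiable at `0` with continuous directional
derivatives, whose classes are the projected classes: `pr_P [Φ_j] = [Ψ_j]`.  Then `Ψ ∈ holCotForms ιinf Kc`: the `K_∞`-type, `Kc`-invariance and
level by ★ `projectedClasses_type` + ★ `mem_weight_level_of_classes`, the holomorphic germs by ★ `projectedClasses_holGerm` + ★
`isHolGerm_of_classes`. [cite: BorelJacquet1979, §4.6] [cite: Borel1997, §5.14 and Thm. 2.13] [cite: BorelWallach2000, XIII 1.2] -/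
theorem mem_holCotForms_of_representative (P : DiscreteAutomorphicRep (adelicGroupData F E c N J) μ)
    {Φ : (adelicGroupData F E c N J).Adelic → (Fin 2 → ℂ)} (hΦ : Φ ∈ holCotForms F E c N J ιinf Kc)
    (hC1Φ : ∀ (b : Fin 2 → ℂ) (j : Fin 2), Continuous fun x => fderiv ℝ (germAt ιinf Φ x) 0 b j)
    (hmemΦ : ∀ j : Fin 2, MemLp (toQuotFun (adelicGroupData F E c N J) fun x => Φ x j) 2 μ)
    {Ψ : (adelicGroupData F E c N J).Adelic → (Fin 2 → ℂ)}
    (hinvΨ : ∀ γ ∈ (adelicGroupData F E c N J).quotientSubgroup, ∀ x, Ψ (γ * x) = Ψ x) (hcΨ : ∀ j : Fin 2, Continuous fun x => Ψ x j)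
    (hdiffΨ : ∀ x, DifferentiableAt ℝ (germAt ιinf Ψ x) 0)
    (hC1Ψ : ∀ (b : Fin 2 → ℂ) (j : Fin 2), Continuous fun x => fderiv ℝ (germAt ιinf Ψ x) 0 b j)
    (hmemΨ : ∀ j : Fin 2, MemLp (toQuotFun (adelicGroupData F E c N J) fun x => Ψ x j) 2 μ)
    (hrep : ∀ j : Fin 2, P.space.toSubmodule.starProjection ((hmemΦ j).toLp _) = ((hmemΨ j).toLp _ : (adelicGroupData F E c N J).L2 μ)) :
    Ψ ∈ holCotForms F E c N J ιinf Kc := by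
  have hinvΦ := leftInvariant_of_mem_holCotForms hΦ
  have hholΦ : IsHolGerm ιinf Φ := (mem_holCotForms_iff.mp hΦ).2.2.2
  -- the three algebraic conjuncts, on the classes of `Ψ`
  obtain ⟨-, hKc, ⟨hopen, hlev⟩, htyp⟩ := projectedClasses_type P hΦ hmemΦ
  have hKcΨ : ∀ k ∈ Kc, ∀ j, (adelicGroupData F E c N J).rightRegular μ k ((hmemΨ j).toLp _) = (hmemΨ j).toLp _ :=
    fun k hk j => by rw [← hrep]; exact hKc k hk j
  have hlevΨ : ∀ g ∈ (rightRep F E c N J).stabilizerSubgroup Φ, ∀ j,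
      (adelicGroupData F E c N J).rightRegular μ (finAdelicToAdelic F E c N J g) ((hmemΨ j).toLp _) = (hmemΨ j).toLp _ :=
    fun g hg j => by rw [← hrep]; exact hlev g hg j
  have htypΨ : ∀ (k : stabilizer U21 x₀) (j : Fin 2), (adelicGroupData F E c N J).rightRegular μ (ιinf k) ((hmemΨ j).toLp _) =
      ∑ i, LinearMap.toMatrix' ((BallForms.isPullbackCocycle_cotangentCocycle.weightOf x₀) k⁻¹) j i • (hmemΨ i).toLp _ :=
    fun k j => by simp only [← hrep]; exact htyp k j
  obtain ⟨hw, hKcfun, hsm⟩ := mem_weight_level_of_classes hinvΨ hcΨ hmemΨ hKcΨ hopen hlevΨ htypΨ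
  -- the fourth conjunct: holomorphic germs
  have hgerm : IsHolGerm ιinf Ψ :=
    isHolGerm_of_classes (ν := μ) hinvΨ hdiffΨ hC1Ψ hmemΨ
      (D := fun b j => P.space.toSubmodule.starProjection ((memLp_fderivGerm (μ := μ) hinvΦ hC1Φ b j).toLp _))
      (fun b j => by rw [← hrep j]; exact (projectedClasses_holGerm P hinvΦ hholΦ hC1Φ hmemΦ b j).1)
      (fun b j => (projectedClasses_holGerm P hinvΦ hholΦ hC1Φ hmemΦ b j).2)
  exact mem_holCotForms_iff.mpr ⟨hw, hKcfun, hsm, hgerm⟩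

/-- **(D)h, ITS OWN SHAPE, FROM A `C¹` REPRESENTATIVE**: under the hypotheses of `mem_holCotForms_of_representative`, there is `Ψ' ∈ holCotForms ιinf Kc`
with square-integrable coordinates whose classes are the projections `pr_P [Φ_j]` (namely `Ψ`). [cite: BorelJacquet1979, §4.6] [cite: Borel1997, Thm. 2.13 and §8.4] -/
theorem exists_holCotForm_of_representative (P : DiscreteAutomorphicRep (adelicGroupData F E c N J) μ)
    {Φ : (adelicGroupData F E c N J).Adelic → (Fin 2 → ℂ)} (hΦ : Φ ∈ holCotForms F E c N J ιinf Kc)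
    (hC1Φ : ∀ (b : Fin 2 → ℂ) (j : Fin 2), Continuous fun x => fderiv ℝ (germAt ιinf Φ x) 0 b j)
    (hmemΦ : ∀ j : Fin 2, MemLp (toQuotFun (adelicGroupData F E c N J) fun x => Φ x j) 2 μ)
    {Ψ : (adelicGroupData F E c N J).Adelic → (Fin 2 → ℂ)}
    (hinvΨ : ∀ γ ∈ (adelicGroupData F E c N J).quotientSubgroup, ∀ x, Ψ (γ * x) = Ψ x) (hcΨ : ∀ j : Fin 2, Continuous fun x => Ψ x j)
    (hdiffΨ : ∀ x, DifferentiableAt ℝ (germAt ιinf Ψ x) 0)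
    (hC1Ψ : ∀ (b : Fin 2 → ℂ) (j : Fin 2), Continuous fun x => fderiv ℝ (germAt ιinf Ψ x) 0 b j)
    (hmemΨ : ∀ j : Fin 2, MemLp (toQuotFun (adelicGroupData F E c N J) fun x => Ψ x j) 2 μ)
    (hrep : ∀ j : Fin 2, P.space.toSubmodule.starProjection ((hmemΦ j).toLp _) = ((hmemΨ j).toLp _ : (adelicGroupData F E c N J).L2 μ)) :
    ∃ Ψ' ∈ holCotForms F E c N J ιinf Kc, ∃ hΨ' : ∀ j : Fin 2, MemLp (toQuotFun (adelicGroupData F E c N J) fun x => Ψ' x j) 2 μ,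
      ∀ j : Fin 2, P.space.toSubmodule.starProjection ((hmemΦ j).toLp _) = ((hΨ' j).toLp _ : (adelicGroupData F E c N J).L2 μ) :=
  ⟨Ψ, mem_holCotForms_of_representative P hΦ hC1Φ hmemΦ hinvΨ hcΨ hdiffΨ hC1Ψ hmemΨ hrep, hmemΨ, hrep⟩

end Generic

/-! ## §2 The CM frame of the letter: the regularity of `Φ` is a theorem, the quotient is compact -/

section CM

variable {L : Type} [Field L] [NumberField L] [IsCMField L] {ι : L →+* ℂ} {H : Matrix (Fin 3) (Fin 3) L} {T : GL (Fin 3) ℂ}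
  {hT : (T : Matrix (Fin 3) (Fin 3) ℂ)ᴴ * H.map ι * (T : Matrix (Fin 3) (Fin 3) ℂ) = Literature.Geometry.ComplexHyperbolic.BallModel.J}

/-- **The Lie derivative along `X_b ∈ 𝔭` IS the directional derivative of the probe**: for a probe real-differentiable at `0`,
`lieDeriv ιinf (liePMat b) (Φ · j) x = (D(germAt ιinf Φ x)(0) b)_j` (★ `BallForms.expMem_smul_liePMat`: `exp (t X_b) = expP (t b)`).
[cite: BorelJacquet1979, §1.5] [cite: Borel1997, §5.14] -/
theorem lieDeriv_liePMat_eq_fderiv_germAt {G : Type*} [Group G] (ιinf : U21 →* G) {Φ : G → (Fin 2 → ℂ)} {x : G}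
    (hx : DifferentiableAt ℝ (germAt ιinf Φ x) 0) (b : Fin 2 → ℂ) (j : Fin 2) :
    lieDeriv (H := BallForms.u21Group) ιinf (BallForms.liePMat b) (fun y => Φ y j) x = fderiv ℝ (germAt ιinf Φ x) 0 b j := by
  simp only [lieDeriv, BallForms.expMem_smul_liePMat]
  have hline : HasDerivAt (fun t : ℝ => t • b) b 0 := by simpa using (hasDerivAt_id (0 : ℝ)).smul_const b
  have hcomp : HasDerivAt (germAt ιinf Φ x ∘ fun t : ℝ => t • b) (fderiv ℝ (germAt ιinf Φ x) 0 b) 0 := by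
    refine HasFDerivAt.comp_hasDerivAt 0 ?_ hline
    rw [zero_smul]
    exact hx.hasFDerivAt
  exact (((ContinuousLinearMap.proj (R := ℝ) j : (Fin 2 → ℂ) →L[ℝ] ℂ).hasFDerivAt).comp_hasDerivAt 0 hcomp).deriv

/-- **Holomorphic cotangent forms of the CM frame have CONTINUOUS directional derivatives along `exp 𝔭`** (they are arch-smooth with continuous
Lie derivatives: F0P2a-p03's ★ `F0P2aL2bHolLieSpanPackage.iterLieDeriv_hol_package` for the word `[X_b]`). [cite: BorelJacquet1979, §1.5 and §4.2]
[cite: Borel1997, §5.14] -/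
theorem continuous_fderivGerm_of_mem_holCotForms_cm
    {Φ : (adelicGroupData (↥(maximalRealSubfield L)) L (IsCMField.complexConj L) 3 H).Adelic → (Fin 2 → ℂ)}
    (hΦ : Φ ∈ holCotForms (↥(maximalRealSubfield L)) L (IsCMField.complexConj L) 3 H (cmArchSection L ι H T hT) (cmCompactFactor L ι H T hT))
    (b : Fin 2 → ℂ) (j : Fin 2) :
    Continuous fun x => fderiv ℝ (germAt (cmArchSection L ι H T hT) Φ x) 0 b j := by
  have hhol : IsHolGerm (cmArchSection L ι H T hT) Φ := (mem_holCotForms_iff.mp hΦ).2.2.2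
  have hc := (F0P2aL2bHolLieSpanPackage.iterLieDeriv_hol_package (hT := hT) hΦ [BallForms.liePMat b] j).2.2.2.2.2
  simp only [iterLieDeriv_cons, iterLieDeriv_nil] at hc
  refine hc.congr fun x => ?_
  exact lieDeriv_liePMat_eq_fderiv_germAt (cmArchSection L ι H T hT) (hhol.1 x) b j

/-- `[L:ℚ] ≥ 4` once `[L⁺:ℚ] ≥ 2` (`[L:ℚ] = 2 [L⁺:ℚ]`). [folklore] -/
theorem four_le_finrank_of_two_le (h2 : 2 ≤ Module.finrank ℚ ↥(maximalRealSubfield L)) : 4 ≤ Module.finrank ℚ L := by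
  have h := Module.finrank_mul_finrank ℚ ↥(maximalRealSubfield L) L
  rw [Algebra.IsQuadraticExtension.finrank_eq_two ↥(maximalRealSubfield L) L] at h
  omega

/-- **The automorphic quotient `U(H)(L⁺)\U(H)(𝔸_{L⁺})` of the letter's setting is COMPACT**: `H` is definite at a complex place `≠` that of `ι`
(which exists as `[L:ℚ] ≥ 4`, ★ `exists_infinitePlace_ne`), so anisotropic, and Godement's criterion applies (★
`compactSpace_cmDatum_automorphicQuotient_of_posDef`). [cite: GelfandGraevPiatetskiShapiro1969, Ch. 1 §2.3] -/
theorem compactSpace_automorphicQuotient_cm (hdef : ∀ τ' : L →+* ℂ, InfinitePlace.mk τ' ≠ InfinitePlace.mk ι → (H.map τ').PosDef)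
    (h2 : 2 ≤ Module.finrank ℚ ↥(maximalRealSubfield L)) :
    CompactSpace (adelicGroupData (↥(maximalRealSubfield L)) L (IsCMField.complexConj L) 3 H).automorphicQuotient := by
  obtain ⟨τ, hτ⟩ := UnitaryGroup.exists_infinitePlace_ne L (four_le_finrank_of_two_le h2) ι
  exact UnitaryGroup.compactSpace_cmDatum_automorphicQuotient_of_posDef L 3 H τ (hdef τ hτ)

/-- **(D)h IN THE LETTER'S SETTING, FROM A `C¹` REPRESENTATIVE OF THE PROJECTED CLASSES.**  In the exact setting of ★
`CotangentForms.holCotFormSpectralProjection` — `L` CM, a frame `T` of signature `(2,1)` at `ι`, `H` definite at the other complex places,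
`[L⁺:ℚ] ≥ 2`, `μ` automorphic, `P` discrete, `Φ ∈ holCotForms` with square-integrable coordinates — IF the projected pair `(pr_P [Φ₀], pr_P [Φ₁])`
has a representative `Ψ` (left-invariant, continuous square-integrable coordinates, probes real-differentiable at `0` along `exp 𝔭`, continuous
directional derivatives: the output of the regularity letter F2), THEN the conclusion of (D)h holds for `(P, Φ)`: there is a holomorphic cotangent
form (namely `Ψ`) whose classes are `pr_P [Φ_j]`.  The regularity of `Φ` itself is a THEOREM here (`continuous_fderivGerm_of_mem_holCotForms_cm`).
[cite: BorelJacquet1979, §4.3 and §4.6] [cite: Borel1997, Thm. 2.13 and §8.4] [cite: HarishChandra1968] [cite: BorelWallach2000, XIII 1.2; VII 2.10] -/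
theorem holCotFormSpectralProjection_of_representative
    (hdef : ∀ τ' : L →+* ℂ, InfinitePlace.mk τ' ≠ InfinitePlace.mk ι → (H.map τ').PosDef) (h2 : 2 ≤ Module.finrank ℚ ↥(maximalRealSubfield L))
    {μ : Measure (adelicGroupData (↥(maximalRealSubfield L)) L (IsCMField.complexConj L) 3 H).automorphicQuotient}
    [(adelicGroupData (↥(maximalRealSubfield L)) L (IsCMField.complexConj L) 3 H).IsAutomorphicMeasure μ]
    (P : DiscreteAutomorphicRep (adelicGroupData (↥(maximalRealSubfield L)) L (IsCMField.complexConj L) 3 H) μ)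
    {Φ : (adelicGroupData (↥(maximalRealSubfield L)) L (IsCMField.complexConj L) 3 H).Adelic → (Fin 2 → ℂ)}
    (hΦ : Φ ∈ holCotForms (↥(maximalRealSubfield L)) L (IsCMField.complexConj L) 3 H (cmArchSection L ι H T hT) (cmCompactFactor L ι H T hT))
    (hmemΦ : ∀ j : Fin 2, MemLp (toQuotFun (adelicGroupData (↥(maximalRealSubfield L)) L (IsCMField.complexConj L) 3 H) fun g => Φ g j) 2 μ)
    {Ψ : (adelicGroupData (↥(maximalRealSubfield L)) L (IsCMField.complexConj L) 3 H).Adelic → (Fin 2 → ℂ)}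
    (hinvΨ : ∀ γ ∈ (adelicGroupData (↥(maximalRealSubfield L)) L (IsCMField.complexConj L) 3 H).quotientSubgroup, ∀ x, Ψ (γ * x) = Ψ x)
    (hcΨ : ∀ j : Fin 2, Continuous fun x => Ψ x j) (hdiffΨ : ∀ x, DifferentiableAt ℝ (germAt (cmArchSection L ι H T hT) Ψ x) 0)
    (hC1Ψ : ∀ (b : Fin 2 → ℂ) (j : Fin 2), Continuous fun x => fderiv ℝ (germAt (cmArchSection L ι H T hT) Ψ x) 0 b j)
    (hmemΨ : ∀ j : Fin 2, MemLp (toQuotFun (adelicGroupData (↥(maximalRealSubfield L)) L (IsCMField.complexConj L) 3 H) fun g => Ψ g j) 2 μ)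
    (hrep : ∀ j : Fin 2, P.space.toSubmodule.starProjection ((hmemΦ j).toLp _) =
      ((hmemΨ j).toLp _ : (adelicGroupData (↥(maximalRealSubfield L)) L (IsCMField.complexConj L) 3 H).L2 μ)) :
    ∃ Ψ' ∈ holCotForms (↥(maximalRealSubfield L)) L (IsCMField.complexConj L) 3 H (cmArchSection L ι H T hT) (cmCompactFactor L ι H T hT),
      ∃ hΨ' : ∀ j : Fin 2,
          MemLp (toQuotFun (adelicGroupData (↥(maximalRealSubfield L)) L (IsCMField.complexConj L) 3 H) fun g => Ψ' g j) 2 μ,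
        ∀ j : Fin 2,
          P.space.toSubmodule.starProjection
              (MemLp.toLp (toQuotFun (adelicGroupData (↥(maximalRealSubfield L)) L (IsCMField.complexConj L) 3 H) fun g => Φ g j) (hmemΦ j)) =
            MemLp.toLp (toQuotFun (adelicGroupData (↥(maximalRealSubfield L)) L (IsCMField.complexConj L) 3 H) fun g => Ψ' g j) (hΨ' j) := by
  haveI := compactSpace_automorphicQuotient_cm (H := H) hdef h2
  exact exists_holCotForm_of_representative P hΦ (continuous_fderivGerm_of_mem_holCotForms_cm hΦ) hmemΦ hinvΨ hcΨ hdiffΨ hC1Ψ hmemΨ hrep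

/-! ### §2′ The same with an ARCH-SMOOTH representative (Borel–Jacquet smoothness, the currency of the `W`-package and of letter F2) -/

-- the operator-norm structure on matrices, under which `u21Group.lie.toSubmodule` is a normed space (as in ★ `UnitaryBallLieDerivative`)
open scoped Matrix.Norms.Operator in
/-- An arch-smooth `ℂ²`-valued function (each coordinate `IsArchSmooth` along `ιinf`, ★ `ArchimedeanCalculus`) has probes `b ↦ Ψ (x · ιinf (expP b))`
real-differentiable at `0` (cf. ★ `BallForms.differentiableAt_comp_expP_of_isArchSmooth`, the case `ιinf = id`). [cite: BorelJacquet1979, §1.1 and §1.5] -/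
theorem differentiableAt_germAt_of_isArchSmooth {G : Type*} [Group G] (ιinf : U21 →* G) {Ψ : G → (Fin 2 → ℂ)}
    (hsm : ∀ j : Fin 2, IsArchSmooth (H := BallForms.u21Group) ιinf fun y => Ψ y j) (x : G) :
    DifferentiableAt ℝ (germAt ιinf Ψ x) 0 := by
  rw [differentiableAt_pi]
  intro j
  have h := ((hsm j x).comp BallForms.liePMatL.contDiff).differentiable (by simp) 0
  have hfun : (fun b : Fin 2 → ℂ => germAt ιinf Ψ x b j) =
      (fun X : BallForms.u21Group.lie.toSubmodule => Ψ (x * ιinf (BallForms.u21Group.expMem ⟨X, X.2⟩)) j) ∘ BallForms.liePMatL := by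
    funext b
    show Ψ (x * ιinf (BallForms.expP b)) j = Ψ (x * ιinf (BallForms.u21Group.expMem (BallForms.liePMat b))) j
    rw [BallForms.expMem_liePMat]
  rw [hfun]
  exact h

/-- **(D)h IN THE LETTER'S SETTING, FROM AN ARCH-SMOOTH REPRESENTATIVE WITH CONTINUOUS LIE DERIVATIVES** — the form in which the regularity letter F2
(«`K_∞`-finite `𝒵`-finite `L²` classes on the compact quotient have smooth representatives») and the B4-archimedean desk state their output:
`holCotFormSpectralProjection_of_representative` with `hdiffΨ`/`hC1Ψ` replaced by `IsArchSmooth cmArchSection (Ψ · j)` and continuity of the Lie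
derivatives `lieDeriv cmArchSection X_b (Ψ · j)`. [cite: BorelJacquet1979, §4.3 and §4.6] [cite: Borel1997, Thm. 2.13 and §8.4] [cite: HarishChandra1968] -/
theorem holCotFormSpectralProjection_of_archSmooth_representative
    (hdef : ∀ τ' : L →+* ℂ, InfinitePlace.mk τ' ≠ InfinitePlace.mk ι → (H.map τ').PosDef) (h2 : 2 ≤ Module.finrank ℚ ↥(maximalRealSubfield L))
    {μ : Measure (adelicGroupData (↥(maximalRealSubfield L)) L (IsCMField.complexConj L) 3 H).automorphicQuotient}
    [(adelicGroupData (↥(maximalRealSubfield L)) L (IsCMField.complexConj L) 3 H).IsAutomorphicMeasure μ]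
    (P : DiscreteAutomorphicRep (adelicGroupData (↥(maximalRealSubfield L)) L (IsCMField.complexConj L) 3 H) μ)
    {Φ : (adelicGroupData (↥(maximalRealSubfield L)) L (IsCMField.complexConj L) 3 H).Adelic → (Fin 2 → ℂ)}
    (hΦ : Φ ∈ holCotForms (↥(maximalRealSubfield L)) L (IsCMField.complexConj L) 3 H (cmArchSection L ι H T hT) (cmCompactFactor L ι H T hT))
    (hmemΦ : ∀ j : Fin 2, MemLp (toQuotFun (adelicGroupData (↥(maximalRealSubfield L)) L (IsCMField.complexConj L) 3 H) fun g => Φ g j) 2 μ)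
    {Ψ : (adelicGroupData (↥(maximalRealSubfield L)) L (IsCMField.complexConj L) 3 H).Adelic → (Fin 2 → ℂ)}
    (hinvΨ : ∀ γ ∈ (adelicGroupData (↥(maximalRealSubfield L)) L (IsCMField.complexConj L) 3 H).quotientSubgroup, ∀ x, Ψ (γ * x) = Ψ x)
    (hcΨ : ∀ j : Fin 2, Continuous fun x => Ψ x j)
    (hsmΨ : ∀ j : Fin 2, IsArchSmooth (H := BallForms.u21Group) (cmArchSection L ι H T hT) fun y => Ψ y j)
    (hLieΨ : ∀ (b : Fin 2 → ℂ) (j : Fin 2),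
      Continuous (lieDeriv (H := BallForms.u21Group) (cmArchSection L ι H T hT) (BallForms.liePMat b) fun y => Ψ y j))
    (hmemΨ : ∀ j : Fin 2, MemLp (toQuotFun (adelicGroupData (↥(maximalRealSubfield L)) L (IsCMField.complexConj L) 3 H) fun g => Ψ g j) 2 μ)
    (hrep : ∀ j : Fin 2, P.space.toSubmodule.starProjection ((hmemΦ j).toLp _) =
      ((hmemΨ j).toLp _ : (adelicGroupData (↥(maximalRealSubfield L)) L (IsCMField.complexConj L) 3 H).L2 μ)) :
    ∃ Ψ' ∈ holCotForms (↥(maximalRealSubfield L)) L (IsCMField.complexConj L) 3 H (cmArchSection L ι H T hT) (cmCompactFactor L ι H T hT),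
      ∃ hΨ' : ∀ j : Fin 2,
          MemLp (toQuotFun (adelicGroupData (↥(maximalRealSubfield L)) L (IsCMField.complexConj L) 3 H) fun g => Ψ' g j) 2 μ,
        ∀ j : Fin 2,
          P.space.toSubmodule.starProjection
              (MemLp.toLp (toQuotFun (adelicGroupData (↥(maximalRealSubfield L)) L (IsCMField.complexConj L) 3 H) fun g => Φ g j) (hmemΦ j)) =
            MemLp.toLp (toQuotFun (adelicGroupData (↥(maximalRealSubfield L)) L (IsCMField.complexConj L) 3 H) fun g => Ψ' g j) (hΨ' j) := by
  have hdiffΨ : ∀ x, DifferentiableAt ℝ (germAt (cmArchSection L ι H T hT) Ψ x) 0 :=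
    differentiableAt_germAt_of_isArchSmooth (cmArchSection L ι H T hT) hsmΨ
  have hC1Ψ : ∀ (b : Fin 2 → ℂ) (j : Fin 2), Continuous fun x => fderiv ℝ (germAt (cmArchSection L ι H T hT) Ψ x) 0 b j :=
    fun b j => (hLieΨ b j).congr fun x => lieDeriv_liePMat_eq_fderiv_germAt (cmArchSection L ι H T hT) (hdiffΨ x) b j
  exact holCotFormSpectralProjection_of_representative hdef h2 P hΦ hmemΦ hinvΨ hcΨ hdiffΨ hC1Ψ hmemΨ hrep

end CM

end Summit.HodgeConjecture.HodgeConjecture.Cruxes.H413.F0P3HolProjectionReduction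

end
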